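import Summits.BirchSwinnertonDyer.Rank1Residual.Additive.TameBranchFullSqueezeLaw
import Summits.BirchSwinnertonDyer.Rank1Residual.Additive.CensusX41Calibration
import Literature.NumberTheory.EllipticCurves.Wuthrich2014.ShaBoundProofs
import HarnessLib

/-!
# THE ANALYTIC ORDER OF Ш IS THE CERTIFICATE (law) — the full squeeze needs NO first-unit-index
# datum, and on defect 2 its `T = 0` input `v_p(ϖ·B^±(0))` IS `ord_p(L(E,1)/Ω_E) = ord_p #Ш_an +
# ord_p ∏c − 2·ord_p #E(ℚ)_tors` (Birch × Pal × Gauss × Mazur–Tate–Teitelbaum)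
# (cell `b2b-bsdres`, sub-cell additive-p2 = X3♯(G-ord)/X4♯(G-ord), gen 32; part 1)

HONEST FRAMING (cell `b2b-bsdres`, run/shared/lean/b2b/bsd-rank1-residual/, verbatim in every
file): the goal of the cell is to DELETE the COMBINATION-SHAPED residual classes of the
Birch–Swinnerton-Dyer formula for ALL analytic-rank `≤ 1` elliptic curves over `ℚ` — "full BSD
formula for every rank `≤ 1` curve in class `C`" assembled STRICTLY from published theorems — so
that the rank-`≤ 1` remainder becomes exactly the CONSTRUCTION-SHAPED classes, which are TYPED
(missing-input `Prop`s), NOT attempted. This is not "finishing BSD". Sub-cell additive-p2: the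
classes X3♯(G-ord) / X4♯(G-ord) are CONSTRUCTION-SHAPED and stay so; labels / RESIDUAL-MAP marks
UNCHANGED; nothing is booked. Theorems only (Λ-algebra, `p`-adic valuations, and the tree's
Birch × Pal × Gauss × MTT calibration `CensusX41.relationAt`); the published inputs are explicit
binders (`LeadingTermClauses W p Dh` = Delbourgo 2002 (B) for a given datum, `hmod` = modularity,
`hGZK` = Gross–Zagier–Kolyvagin). No definition, no named fact, no `sorry`.

## What and why

Gen 31 proved the FULL SQUEEZE per cyclotomic datum (`TameBranchFullSqueeze.fullSqueeze_rank{Zero,One}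
_of_iota_eq_of_firstTop`): a Kato-type `g ∈ char_Λ X(E/ℚ_∞)` with `ι g = p^k·B`, `B` bounded by `p^c`
with FIRST TOP coefficient at `n`, a bound `μ(fE) ≤ m` and ONE BSD-side inequality at `T = 0` force
`λ(fE) = n`, `μ(fE) = m`, `Ш(E/ℚ)[p^∞] = 0`, `ℓ_p = 1`, `char_Λ X = (G)`; its defect-2 consumers
carried the per-pair certificate "first unit coefficient of `ϖ·B^±` at index `n`" (the census's
`(μ_an, λ_an)` column). §1 REMOVES that datum: for ANY `g ∈ char_Λ X` with `ι g = X` take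
`(m, n) := (μ(g), λ(g))`, `B := ι(pfree g)` — the first top of `B` is AUTOMATICALLY at `λ(g)`
(Washington §7.1), `μ(fE) ≤ μ(g)` comes from `fE ∣ g`, and the hypothesis is literally
`v_p(X(0)) + 2·ord_p #tors ≤ ord_p ∏c`; conclusion **`char_Λ X = (g)`** (the Kato element GENERATES),
`μ(fE) = μ(g)`, `λ(fE) = λ(g)`, `#Ш[p^∞] = 1`, every admissible `ℓ = 1`
(`fullSqueeze_rankZero_of_iota_eq`; rank 1 `fullSqueeze_rankOne_of_iota_eq` with
`v_p([T¹]X) + 1 + 2t ≤ v + ord_p ∏c`, `v ≤ ord_p Reg_p(E,Dh)`) — Greenberg's principle "Kato's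
divisibility + equality at `T = 0` ⟹ the main conjecture" VERBATIM in the tame-branch currency.

§2 identifies the `T = 0` input on DEFECT 2: for `E = W` additive at the odd prime `p`, `C • V^{(p*)}
= W` with `V = E♭` globally minimal ordinary at `p`, newform `f`, period ratio `ϖ` of the parity of
`(p−1)/2`, the Néron-normalised branch has `(ϖ·B^±)(0) = u·(L(E,1)/Ω_E)` with `u` a `p`-adic UNIT
(`α⁻¹` resp. `α⁻¹·c_∞(E)`) — the tree's calibration `CensusX41.relationAt` (census-ctyper1: Birch (8.6)
× Pal 2012 Thm. 3.2 × Gauss's sign × MTT (10.1)/§I.13) — so **`v_p(ϖ·B^±(0)) = ord_p(L(E,1)/Ω_E)`**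
and, at analytic rank `0` with Miller's `#Ш_an = (L(E,1)/Ω_E)·#E(ℚ)²/∏c`
(`Wuthrich2014.shaAn_eq_of_L_one_div_eq`, GZK), **`v_p(ϖ·B^±(0)) + 2·ord_p #E(ℚ)_tors =
ord_p #Ш_an(E) + ord_p ∏c_ℓ`**: gen 31's rank-0 full-squeeze hypothesis on defect 2 is EXACTLY
**`ord_p #Ш_an(E) ≤ 0`** (Cremona's column; no `p`-adic computation), its "margin" `−ord_p #Ш_an`.
Parts 2–3 of gen 32 draw the class-level consequences. Nothing booked; labels UNCHANGED.

References: Greenberg LNM 1716 §4 pp. 102–110 [GreenbergLNM1716]; Greenberg–Vatsal 2000 p. 4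
[GreenbergVatsal2000]; Washington GTM 83 §7.1 [Washington1997]; Delbourgo 2002 Thm. (B) p. 40
[Delbourgo2002]; Mazur–Tate–Teitelbaum 1986 §I.8 (8.6), §I.10 (10.1), §I.13–I.14
[MazurTateTeitelbaum1986Invent]; Pal 2012 Thm. 3.2 [Pal2012]; Miller 2011 §1 [Miller2011LMS];
`TameBranchFullSqueezeLaw.lean` (gen 31), `CensusX41Calibration.lean` (census-ctyper1). -/

set_option autoImplicit false

noncomputable section

open scoped Classical MatrixGroups ModularForm NumberField

open CongruenceSubgroup IsDedekindDomain WeierstrassCurve NumberField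
  Literature.NumberTheory.EllipticCurves
  Literature.NumberTheory.EllipticCurves.ModularForms
  Literature.NumberTheory.EllipticCurves.Rank1Residual
  Literature.NumberTheory.EllipticCurves.Rank1Residual.Typed
  Literature.NumberTheory.EllipticCurves.Delbourgo2002
  Summit.BirchSwinnertonDyer.Rank1Residual.X1.MuLambda
  Summit.BirchSwinnertonDyer.Rank1Residual.X1.RankOneParitySqueeze
  Summit.BirchSwinnertonDyer.Rank1Residual.X11a.LambdaNorm

namespace Summit.BirchSwinnertonDyer.Rank1Residual.Additive

namespace TameBranchAnalyticSha

/-! ### §0 Λ-algebra: the first top of `ι(pfree g)` sits at `λ(g)`, automatically -/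

section Algebra

open TameBranchExtraZeros TameBranchLambdaParity

variable {p : ℕ} [hp : Fact p.Prime]

/-- **The `μ`-decomposition through `ι`.** `ι g = p^{μ(g)} · ι(pfree g)`. [cite: Washington1997, §7.1] -/
theorem iota_eq_C_pow_mu_mul_iota_pfree (g : IwasawaAlgebra p) :
    iwasawaToPowerSeries p g =
      PowerSeries.C ((p : ℚ_[p]) ^ mu g) * iwasawaToPowerSeries p (pfree g) := by
  conv_lhs => rw [eq_C_pow_mu_mul_pfree g]
  rw [map_mul, PowerSeries.map_C]
  congr 2

/-- `ι(pfree g)` is integral: `‖[Tʲ] ι(pfree g)‖ ≤ 1 = p⁰`. [folklore] -/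
theorem norm_coeff_iota_pfree_le (g : IwasawaAlgebra p) (j : ℕ) :
    ‖PowerSeries.coeff j (iwasawaToPowerSeries p (pfree g))‖ ≤ (p : ℝ) ^ (0 : ℕ) := by
  rw [pow_zero, Wuthrich2014.coeff_iwasawaToPowerSeries p (pfree g) j, PadicInt.padic_norm_e_of_padicInt]
  exact PadicInt.norm_le_one _

/-- **The first top of `ι(pfree g)` is at `λ(g)`** (`g ≠ 0`): `‖[T^{λ(g)}] ι(pfree g)‖ = 1` and
`‖[Tⁱ] ι(pfree g)‖ < 1` for `i < λ(g)` (`μ(pfree g) = 0`, `λ(pfree g) = λ(g)`, Washington §7.1).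
[cite: Washington1997, §7.1] -/
theorem firstTop_iota_pfree {g : IwasawaAlgebra p} (hg : g ≠ 0) :
    ‖PowerSeries.coeff (lam g) (iwasawaToPowerSeries p (pfree g))‖ = (p : ℝ) ^ (0 : ℕ) ∧
      ∀ i < lam g, ‖PowerSeries.coeff i (iwasawaToPowerSeries p (pfree g))‖ < (p : ℝ) ^ (0 : ℕ) := by
  obtain ⟨hμ, hlam⟩ := mu_pfree_eq_zero_and_lam_pfree_eq hg
  have hpf : pfree g ≠ 0 := pfree_ne_zero hg
  refine ⟨?_, fun i hi ↦ ?_⟩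
  · obtain ⟨hne, hval⟩ := valuation_coeff_lam hpf
    rw [hlam, hμ, Nat.cast_zero] at hval
    rw [hlam] at hne
    rw [Wuthrich2014.coeff_iwasawaToPowerSeries p (pfree g) (lam g)]
    exact (norm_eq_pow_iff_valuation_eq hne 0).mpr (by rw [hval]; simp)
  · rw [pow_zero, Wuthrich2014.coeff_iwasawaToPowerSeries p (pfree g) i,
      PadicInt.padic_norm_e_of_padicInt]
    exact norm_coeff_pfree_lt_one_of_lt_lam hg hi

/-- Coefficients through the `μ`-decomposition: `[Tʲ](ι g) = p^{μ(g)}·[Tʲ] ι(pfree g)`, so a non-zero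
`[Tʲ](ι g)` has `v_p = μ(g) + v_p([Tʲ] ι(pfree g))` and `[Tʲ] ι(pfree g) ≠ 0`. [cite: Washington1997, §7.1] -/
theorem valuation_coeff_iota_eq_mu_add {g : IwasawaAlgebra p} {X : PowerSeries ℚ_[p]}
    (hι : iwasawaToPowerSeries p g = X) {j : ℕ} (hj : PowerSeries.coeff j X ≠ 0) :
    PowerSeries.coeff j (iwasawaToPowerSeries p (pfree g)) ≠ 0 ∧
      (PowerSeries.coeff j X).valuation =
        mu g + (PowerSeries.coeff j (iwasawaToPowerSeries p (pfree g))).valuation := by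
  have hpQ : (p : ℚ_[p]) ≠ 0 := Nat.cast_ne_zero.mpr hp.out.ne_zero
  have e : PowerSeries.coeff j X =
      (p : ℚ_[p]) ^ mu g * PowerSeries.coeff j (iwasawaToPowerSeries p (pfree g)) := by
    rw [← hι, iota_eq_C_pow_mu_mul_iota_pfree g, PowerSeries.coeff_C_mul]
  have hne : PowerSeries.coeff j (iwasawaToPowerSeries p (pfree g)) ≠ 0 := by
    intro h0; apply hj; rw [e, h0, mul_zero]
  refine ⟨hne, ?_⟩
  rw [e, Padic.valuation_mul (pow_ne_zero _ hpQ) hne, Padic.valuation_pow, Padic.valuation_p, mul_one]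

/-- `μ(fE) ≤ μ(g)` for `g ∈ (fE)`, `g ≠ 0` (`μ` is additive). [cite: Washington1997, §7.1] -/
theorem mu_le_mu_of_mem_span {fE g : IwasawaAlgebra p} (hg : g ∈ Ideal.span {fE}) (hg0 : g ≠ 0) :
    mu fE ≤ mu g := by
  obtain ⟨h, hh⟩ := Ideal.mem_span_singleton'.mp hg
  have hfac : g = fE * h := by rw [← hh, mul_comm]
  have hfE : fE ≠ 0 := by intro e; apply hg0; rw [hfac, e, zero_mul]
  have hh0 : h ≠ 0 := by intro e; apply hg0; rw [hfac, e, mul_zero]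
  rw [hfac]
  exact mu_le_mu_mul hfE hh0

end Algebra

/-! ### §1 Per datum: the full squeeze WITHOUT a first-top hypothesis — `char_Λ X = (g)` -/

section PerDatum

open TameBranchExtraZeros TameBranchLambdaParity TameBranchFullSqueeze

variable {W : WeierstrassCurve ℚ} [W.IsElliptic] {p : ℕ} [hp : Fact p.Prime]

/-- **THE FULL SQUEEZE AT RANK ZERO, NO FIRST-TOP DATUM (per cyclotomic datum).** `p ≠ 2`,
`rank_ℤ E(ℚ) = 0`, a (B)-datum `Dh`, a cyclotomic dual datum `D` of `Sel_{p^∞}(E/ℚ_∞)` with `X`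
torsion and generator `fE`, and ANY `g ∈ char_Λ X` with image `ι g = X`, `X(0) ≠ 0` and
**`v_p(X(0)) + 2·ord_p #E(ℚ)_tors ≤ ord_p ∏c_ℓ`**. Then **`char_Λ X = (g)`** (the Kato-type element GENERATES), **`μ(fE) = μ(g)`**, **`λ(fE) = λ(g)`**,
**`#Ш(E/ℚ)[p^∞] = 1`**, `v_p(fE(0)) = v_p(X(0))`, and **every `(u, ℓ)` fitting clause 3 of (B) has
`ℓ = 1`**. Proof: gen 31's `fullSqueeze_rankZero_of_iota_eq_of_firstTop` with `(m, n) := (μ(g), λ(g))`,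
`B := ι(pfree g)` (first top automatic, §0), `μ(fE) ≤ μ(g)` from `fE ∣ g`; the output generator has
`ι G = ι g`, so `G = g`. [cite: GreenbergLNM1716, §4 pp. 102–110] [cite: GreenbergVatsal2000, p. 4]
[cite: Delbourgo2002, Theorem (B) (p. 40)] [cite: Washington1997, §7.1] -/
theorem fullSqueeze_rankZero_of_iota_eq (hp2 : p ≠ 2)
    (hr0 : W.mordellWeilRank = 0) {Dh : PAdicHeightData W p} (hBcl : LeadingTermClauses W p Dh)
    {κ : ZpExtension ℚ p} {γ : Field.absoluteGaloisGroup ℚ}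
    (hκ : κ.IsCyclotomic) (hγ : κ.IsTopGenerator γ) (hγ' : IsCyclotomicVariable p γ)
    (D : W.SelmerDualData κ γ) [Module.Finite (IwasawaAlgebra p) D.X] (hX : D.IsTorsion)
    {fE g : IwasawaAlgebra p} (hchar : D.charIdeal = Ideal.span {fE}) (hg : g ∈ D.charIdeal)
    {X : PowerSeries ℚ_[p]} (hι : iwasawaToPowerSeries p g = X)
    (hX0 : PowerSeries.constantCoeff X ≠ 0)
    (hfull : (PowerSeries.constantCoeff X).valuation + 2 * padicValNat p W.torsionOrder ≤
      padicValNat p W.tamagawaProduct) :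
    D.charIdeal = Ideal.span {g} ∧ mu fE = mu g ∧ lam fE = lam g ∧
      Nat.card (AddCommGroup.primaryComponent W.sha p) = 1 ∧
      (((PowerSeries.constantCoeff fE : ℤ_[p]) : ℚ_[p])).valuation =
        (PowerSeries.constantCoeff X).valuation ∧
      (∀ (u : ℤ_[p]ˣ) (ℓ : ℕ), ℓ ∣ p ^ 2 →
        ((PowerSeries.coeff W.mordellWeilRank fE : ℤ_[p]) : ℚ_[p]) *
            padicLog p (cyclotomicGenerator p) ^ W.mordellWeilRank * (W.torsionOrder : ℚ_[p]) ^ 2 =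
          ((u : ℤ_[p]) : ℚ_[p]) * (ℓ : ℚ_[p]) *
            ((Nat.card (AddCommGroup.primaryComponent W.sha p) : ℚ_[p]) *
              padicRegulator Dh * W.tamagawaProduct) → ℓ = 1) := by
  have hg0 : g ≠ 0 := by
    intro h0; apply hX0; rw [← hι, h0, map_zero, map_zero]
  have hιB := iota_eq_C_pow_mu_mul_iota_pfree (p := p) g
  have hbd := norm_coeff_iota_pfree_le (p := p) g
  obtain ⟨hn, hlt⟩ := firstTop_iota_pfree (p := p) hg0
  have hX0' : PowerSeries.coeff 0 X ≠ 0 := by rwa [PowerSeries.coeff_zero_eq_constantCoeff]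
  obtain ⟨hB0, hvX⟩ := valuation_coeff_iota_eq_mu_add hι hX0'
  rw [PowerSeries.coeff_zero_eq_constantCoeff] at hB0 hvX
  have hμle : mu fE ≤ mu g := mu_le_mu_of_mem_span (by rw [← hchar]; exact hg) hg0
  obtain ⟨hlam, hμ, hcard, hcoef, hℓ, G, hG, -, -, hιG⟩ :=
    fullSqueeze_rankZero_of_iota_eq_of_firstTop hp2 hr0 hBcl hκ hγ hγ' D hX hchar hg hιB hbd hn hlt
      hB0 hμle (by simp only [Nat.cast_zero, add_zero]; linarith)
  have hGg : G = g := by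
    apply iwasawaToPowerSeries_injective p
    rw [hιG, add_zero, ← hιB]
  refine ⟨by rw [hG, hGg], hμ, hlam, hcard, ?_, hℓ⟩
  rw [hcoef, hvX]
  push_cast
  ring

/-- **THE FULL SQUEEZE AT RANK ONE, NO FIRST-TOP DATUM (per cyclotomic datum).** `p ≠ 2`,
`rank_ℤ E(ℚ) = 1`, a (B)-datum `Dh`, a cyclotomic dual datum with `X` torsion and generator `fE`,
ANY `g ∈ char_Λ X` with `ι g = X` and `[T¹]X ≠ 0`, a certified `v ≤ ord_p Reg_p(E,Dh)`, and
**`v_p([T¹]X) + 1 + 2·ord_p #E(ℚ)_tors ≤ v + ord_p ∏c_ℓ`** (census: `v_p(A′) + 2t ≤ v_h + ord_p ∏c`).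
Then Schneider's conjecture for `Dh`, **`char_Λ X = (g)`**, `μ(fE) = μ(g)`, `λ(fE) = λ(g)`,
**`#Ш(E/ℚ)[p^∞] = 1`**, **`ord_p Reg_p(E,Dh) = v`**, `v_p([T¹]fE) = v_p([T¹]X)`, and every admissible
`ℓ` is `1`. [cite: GreenbergLNM1716, §4 pp. 102–110] [cite: GreenbergVatsal2000, p. 4]
[cite: Delbourgo2002, Theorem (B) (p. 40)] [cite: Washington1997, §7.1] -/
theorem fullSqueeze_rankOne_of_iota_eq (hp2 : p ≠ 2)
    (hr1 : W.mordellWeilRank = 1) {Dh : PAdicHeightData W p} (hBcl : LeadingTermClauses W p Dh)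
    {κ : ZpExtension ℚ p} {γ : Field.absoluteGaloisGroup ℚ}
    (hκ : κ.IsCyclotomic) (hγ : κ.IsTopGenerator γ) (hγ' : IsCyclotomicVariable p γ)
    (D : W.SelmerDualData κ γ) [Module.Finite (IwasawaAlgebra p) D.X] (hX : D.IsTorsion)
    {fE g : IwasawaAlgebra p} (hchar : D.charIdeal = Ideal.span {fE}) (hg : g ∈ D.charIdeal)
    {X : PowerSeries ℚ_[p]} (hι : iwasawaToPowerSeries p g = X)
    (hX1 : PowerSeries.coeff 1 X ≠ 0) {v : ℤ} (hv : v ≤ (padicRegulator Dh).valuation)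
    (hfull : (PowerSeries.coeff 1 X).valuation + 1 + 2 * padicValNat p W.torsionOrder ≤
      v + padicValNat p W.tamagawaProduct) :
    SchneiderConjecture Dh ∧ D.charIdeal = Ideal.span {g} ∧ mu fE = mu g ∧ lam fE = lam g ∧
      Nat.card (AddCommGroup.primaryComponent W.sha p) = 1 ∧ (padicRegulator Dh).valuation = v ∧
      (((PowerSeries.coeff 1 fE : ℤ_[p]) : ℚ_[p])).valuation = (PowerSeries.coeff 1 X).valuation ∧
      (∀ (u : ℤ_[p]ˣ) (ℓ : ℕ), ℓ ∣ p ^ 2 →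
        ((PowerSeries.coeff W.mordellWeilRank fE : ℤ_[p]) : ℚ_[p]) *
            padicLog p (cyclotomicGenerator p) ^ W.mordellWeilRank * (W.torsionOrder : ℚ_[p]) ^ 2 =
          ((u : ℤ_[p]) : ℚ_[p]) * (ℓ : ℚ_[p]) *
            ((Nat.card (AddCommGroup.primaryComponent W.sha p) : ℚ_[p]) *
              padicRegulator Dh * W.tamagawaProduct) → ℓ = 1) := by
  have hg0 : g ≠ 0 := by
    intro h0; apply hX1; rw [← hι, h0, map_zero, map_zero]
  have hιB := iota_eq_C_pow_mu_mul_iota_pfree (p := p) g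
  have hbd := norm_coeff_iota_pfree_le (p := p) g
  obtain ⟨hn, hlt⟩ := firstTop_iota_pfree (p := p) hg0
  obtain ⟨hB1, hvX⟩ := valuation_coeff_iota_eq_mu_add hι hX1
  have hμle : mu fE ≤ mu g := mu_le_mu_of_mem_span (by rw [← hchar]; exact hg) hg0
  obtain ⟨hS, hlam, hμ, hcard, hReg, hcoef, hℓ, G, hG, -, -, hιG⟩ :=
    fullSqueeze_rankOne_of_iota_eq_of_firstTop hp2 hr1 hBcl hκ hγ hγ' D hX hchar hg hιB hbd hn hlt
      hB1 hμle hv (by simp only [Nat.cast_zero, add_zero]; linarith)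
  have hGg : G = g := by
    apply iwasawaToPowerSeries_injective p
    rw [hιG, add_zero, ← hιB]
  refine ⟨hS, by rw [hG, hGg], hμ, hlam, hcard, hReg, ?_, hℓ⟩
  rw [hcoef, hvX]
  push_cast
  ring

end PerDatum

/-! ### §2 Defect 2: `v_p(ϖ·B^±(0)) = ord_p(L(E,1)/Ω_E) = ord_p #Ш_an + ord_p ∏c − 2·ord_p #tors` -/

section Dictionary

variable {W : WeierstrassCurve ℚ} [W.IsElliptic] [W.IsGloballyMinimal] {p : ℕ} [hp : Fact p.Prime]

/-- **THE CONSTANT TERM OF THE NÉRON-NORMALISED BRANCH IS `L(E,1)/Ω_E` UP TO A `p`-ADIC UNIT.**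
`E = W` additive at the odd prime `p`, `C • V^{(p*)} = W` with `V = E♭` globally minimal and ORDINARY
at `p` (good reduction), `f` the newform of `V`, `ϖ` the period ratio of the parity of `(p−1)/2`
(`ϖ·Ω_V = Ω⁺_f` resp. `ϖ·|Ω⁻_V| = Ω⁻_f`). Then there are a rational `q` with `L(E,1)/Ω_E = q` and a
`p`-adic UNIT `u` (`u = α⁻¹` at `p ≡ 1 (mod 4)`, `u = α⁻¹·c_∞(E)` at `p ≡ 3 (mod 4)`, `α` the unit
root, `c_∞(E) ∈ {1,2}`) with **`(ϖ·B^±_{(p−1)/2}(f, α))(0) = u·q`**. This is the tree's calibration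
`CensusX41.relationAt` (Birch's formula (8.6) × Pal 2012 Thm. 3.2 × Gauss's sign × MTT (10.1)/§I.13).
[cite: MazurTateTeitelbaum1986Invent, §I.8 (8.6), §I.10 (10.1), §I.13–I.14] [cite: Pal2012, Thm. 3.2] -/
theorem exists_rat_and_unit_constantCoeff_branch_eq (hmod : hasEntireLFunction_rat) (hp2 : p ≠ 2)
    (hadd : Addv W p) (V : WeierstrassCurve ℚ) [V.IsElliptic] [V.IsGloballyMinimal]
    (C : VariableChange ℚ) (hC : C • V.quadraticTwist ((-1 : ℚ) ^ (p / 2) * p) = W)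
    (hord : IsOrdinaryAt V p) {N : ℕ} [NeZero N] {f : CuspForm (Gamma0 N) 2} (hf : IsNewformOf V f)
    (ϖ : ℚ) (hϖ : if Even (p / 2) then (ϖ : ℝ) * V.realPeriodRat = plusPeriod f
      else (ϖ : ℝ) * V.imaginaryPeriodRat = minusPeriod f) :
    ∃ (q : ℚ) (u : ℚ_[p]), u ≠ 0 ∧ u.valuation = 0 ∧
      W.entireLFunction 1 / (W.realPeriodRat : ℂ) = (q : ℂ) ∧
      PowerSeries.constantCoeff (PowerSeries.C (ϖ : ℚ_[p]) *
          (if Even (p / 2) then padicLFunctionBranch f ((unitRoot V p : ℤ_[p]) : ℚ_[p]) (p / 2)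
            else padicLFunctionMinusBranch f ((unitRoot V p : ℤ_[p]) : ℚ_[p]) (p / 2))) =
        u * (q : ℚ_[p]) := by
  have hΩ : (W.realPeriodRat : ℂ) ≠ 0 := by exact_mod_cast W.realPeriodRat_pos_holds.ne'
  -- the unit root is a unit
  obtain ⟨-, hαu⟩ := unitRoot_spec_holds V p hord
  obtain ⟨α, hα⟩ := hαu
  have hα0 : ((unitRoot V p : ℤ_[p]) : ℚ_[p]) ≠ 0 := by rw [← hα]; exact coe_units_ne_zero p α
  have hαv : (((unitRoot V p : ℤ_[p]) : ℚ_[p]))⁻¹.valuation = 0 := by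
    rw [Padic.valuation_inv, ← hα, valuation_coe_units_eq_zero, neg_zero]
  have hrel := CensusX41.relationAt p hmod W V C f hadd (Or.inl hord.1) hf
  have hodd : p % 4 = 1 ∨ p % 4 = 3 := by
    obtain ⟨k, hk⟩ := hp.out.odd_of_ne_two hp2
    omega
  rcases hodd with h1 | h3
  · -- `p ≡ 1 (mod 4)`: even branch, plus symbols, `p* = p`
    have heven : Even (p / 2) := ⟨p / 4, by omega⟩
    have hC' : C • V.quadraticTwist (p : ℚ) = W := by
      have e : ((-1 : ℚ) ^ (p / 2) * p) = (p : ℚ) := by rw [heven.neg_one_pow, one_mul]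
      rw [e] at hC
      exact hC
    rw [if_pos heven] at hϖ
    obtain ⟨hL, hA, -⟩ := hrel.1 h1 hC' ϖ hϖ
    refine ⟨ϖ * legendrePlusSymbolSum f p, (((unitRoot V p : ℤ_[p]) : ℚ_[p]))⁻¹, inv_ne_zero hα0,
      hαv, by rw [hL, mul_div_cancel_right₀ _ hΩ], ?_⟩
    rw [if_pos heven, map_mul, PowerSeries.constantCoeff_C, hA hord]
    push_cast
    ring
  · -- `p ≡ 3 (mod 4)`: odd branch, minus symbols, `p* = −p`
    have ho : Odd (p / 2) := ⟨p / 4, by omega⟩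
    have hnot : ¬ Even (p / 2) := Nat.not_even_iff_odd.mpr ho
    have hC' : C • V.quadraticTwist (-(p : ℚ)) = W := by
      have e : ((-1 : ℚ) ^ (p / 2) * p) = -(p : ℚ) := by rw [ho.neg_one_pow, neg_one_mul]
      rw [e] at hC
      exact hC
    rw [if_neg hnot] at hϖ
    obtain ⟨hL, hA, -⟩ := hrel.2 h3 hC' ϖ hϖ
    have hcP0 : ((W.baseChange ℝ).numRealComponents : ℚ_[p]) ≠ 0 := by
      exact_mod_cast (W.baseChange ℝ).numRealComponents_pos.ne'
    have hcv : ((W.baseChange ℝ).numRealComponents : ℚ_[p]).valuation = 0 := by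
      rw [Padic.valuation_natCast, Nat.cast_eq_zero]
      unfold WeierstrassCurve.numRealComponents
      split_ifs
      · exact padicValNat_primes hp2
      · simp
    refine ⟨ϖ * legendreMinusSymbolSum f p / ((W.baseChange ℝ).numRealComponents : ℚ),
      (((unitRoot V p : ℤ_[p]) : ℚ_[p]))⁻¹ * ((W.baseChange ℝ).numRealComponents : ℚ_[p]),
      mul_ne_zero (inv_ne_zero hα0) hcP0,
      by rw [Padic.valuation_mul (inv_ne_zero hα0) hcP0, hαv, hcv, add_zero],
      by rw [hL, mul_div_cancel_right₀ _ hΩ], ?_⟩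
    rw [if_neg hnot, map_mul, PowerSeries.constantCoeff_C, hA hord]
    push_cast
    field_simp

/-- **`v_p(ϖ·B^±(0)) = ord_p(L(E,1)/Ω_E)`** on the defect-2 (G-ord) locus: with `q = L(E,1)/Ω_E ∈ ℚ`
as in `exists_rat_and_unit_constantCoeff_branch_eq`, the constant term of the Néron-normalised branch
has `p`-adic valuation `ord_p q` (the unit `u` drops out; both sides read `0` when `L(E,1) = 0`).
[cite: MazurTateTeitelbaum1986Invent, §I.8 (8.6), §I.13–I.14] [cite: Pal2012, Thm. 3.2] -/
theorem valuation_constantCoeff_branch_eq_padicValRat (hmod : hasEntireLFunction_rat) (hp2 : p ≠ 2)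
    (hadd : Addv W p) (V : WeierstrassCurve ℚ) [V.IsElliptic] [V.IsGloballyMinimal]
    (C : VariableChange ℚ) (hC : C • V.quadraticTwist ((-1 : ℚ) ^ (p / 2) * p) = W)
    (hord : IsOrdinaryAt V p) {N : ℕ} [NeZero N] {f : CuspForm (Gamma0 N) 2} (hf : IsNewformOf V f)
    (ϖ : ℚ) (hϖ : if Even (p / 2) then (ϖ : ℝ) * V.realPeriodRat = plusPeriod f
      else (ϖ : ℝ) * V.imaginaryPeriodRat = minusPeriod f) :
    ∃ q : ℚ, W.entireLFunction 1 / (W.realPeriodRat : ℂ) = (q : ℂ) ∧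
      (PowerSeries.constantCoeff (PowerSeries.C (ϖ : ℚ_[p]) *
          (if Even (p / 2) then padicLFunctionBranch f ((unitRoot V p : ℤ_[p]) : ℚ_[p]) (p / 2)
            else padicLFunctionMinusBranch f ((unitRoot V p : ℤ_[p]) : ℚ_[p]) (p / 2)))).valuation =
        padicValRat p q := by
  obtain ⟨q, u, hu0, huv, hLq, hA⟩ :=
    exists_rat_and_unit_constantCoeff_branch_eq hmod hp2 hadd V C hC hord hf ϖ hϖ
  refine ⟨q, hLq, ?_⟩
  rw [hA]
  by_cases hq : q = 0
  · rw [hq, Rat.cast_zero, mul_zero, Padic.valuation_zero, padicValRat.zero]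
  · have hqP : (q : ℚ_[p]) ≠ 0 := by exact_mod_cast hq
    rw [Padic.valuation_mul hu0 hqP, huv, zero_add, Padic.valuation_ratCast]

/-- **AT ANALYTIC RANK ZERO: `v_p(ϖ·B^±(0)) + 2·ord_p #E(ℚ)_tors = ord_p #Ш_an(E) + ord_p ∏c_ℓ`.**
Setting of `valuation_constantCoeff_branch_eq_padicValRat` with `L(E,1) ≠ 0`; `#Ш_an(E) = shaAn W`
is Miller's analytic order of `Ш` (a rational `s` here), `= (L(E,1)/Ω_E)·#E(ℚ)²/∏c` by
Gross–Zagier–Kolyvagin (`hGZK`: `E(ℚ)` finite, `Reg = 1`). So gen 31's full-squeeze hypothesis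
`v_p(ϖ·B^±(0)) + 2t ≤ ord_p ∏c` on defect 2 reads **`ord_p #Ш_an(E) ≤ 0`** — and its "margin" is
`−ord_p #Ш_an(E)`, a theorem. [cite: Miller2011LMS, §1 (arXiv:1010.2431 p. 3)]
[cite: MazurTateTeitelbaum1986Invent, §I.8 (8.6), §I.13–I.14] [cite: Pal2012, Thm. 3.2] -/
theorem valuation_constantCoeff_branch_add_eq_padicValRat_shaAn_add (hmod : hasEntireLFunction_rat)
    (hGZK : rank_eq_analyticRank_of_analyticRank_le_one) (hp2 : p ≠ 2) (hadd : Addv W p)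
    (hL : W.entireLFunction 1 ≠ 0) (V : WeierstrassCurve ℚ) [V.IsElliptic] [V.IsGloballyMinimal]
    (C : VariableChange ℚ) (hC : C • V.quadraticTwist ((-1 : ℚ) ^ (p / 2) * p) = W)
    (hord : IsOrdinaryAt V p) {N : ℕ} [NeZero N] {f : CuspForm (Gamma0 N) 2} (hf : IsNewformOf V f)
    (ϖ : ℚ) (hϖ : if Even (p / 2) then (ϖ : ℝ) * V.realPeriodRat = plusPeriod f
      else (ϖ : ℝ) * V.imaginaryPeriodRat = minusPeriod f)
    {s : ℚ} (hs : shaAn W = (s : ℂ)) :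
    (PowerSeries.constantCoeff (PowerSeries.C (ϖ : ℚ_[p]) *
          (if Even (p / 2) then padicLFunctionBranch f ((unitRoot V p : ℤ_[p]) : ℚ_[p]) (p / 2)
            else padicLFunctionMinusBranch f ((unitRoot V p : ℤ_[p]) : ℚ_[p]) (p / 2)))).valuation +
        2 * padicValNat p W.torsionOrder =
      padicValRat p s + padicValNat p W.tamagawaProduct := by
  have hΩ : (W.realPeriodRat : ℂ) ≠ 0 := by exact_mod_cast W.realPeriodRat_pos_holds.ne'
  obtain ⟨q, hLq, hval⟩ :=
    valuation_constantCoeff_branch_eq_padicValRat hmod hp2 hadd V C hC hord hf ϖ hϖ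
  obtain ⟨-, hfin, -, hshaAn⟩ := Wuthrich2014.shaAn_eq_of_L_one_div_eq hGZK W hL hLq
  haveI := hfin
  have hq0 : q ≠ 0 := by
    intro h0
    apply hL
    have e : W.entireLFunction 1 = (q : ℂ) * (W.realPeriodRat : ℂ) := by
      rw [← hLq, div_mul_cancel₀ _ hΩ]
    rw [e, h0, Rat.cast_zero, zero_mul]
  have hT : W.torsionOrder = Nat.card W.toAffine.Point := W.torsionOrder_eq_natCard_of_finite
  have hT0 : (Nat.card W.toAffine.Point : ℚ) ≠ 0 := by
    rw [← hT]; exact_mod_cast W.torsionOrder_pos_holds.ne'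
  have hc0 : (W.tamagawaProduct : ℚ) ≠ 0 := by
    exact_mod_cast (W.tamagawaProduct_pos_holds : 0 < W.tamagawaProduct).ne'
  have hs' : s = q * (Nat.card W.toAffine.Point : ℚ) ^ 2 / (W.tamagawaProduct : ℚ) := by
    exact_mod_cast hs.symm.trans hshaAn
  rw [hval, hs', padicValRat.div (mul_ne_zero hq0 (pow_ne_zero 2 hT0)) hc0,
    padicValRat.mul hq0 (pow_ne_zero 2 hT0), padicValRat.pow, padicValRat.of_nat, padicValRat.of_nat, hT]
  push_cast
  ring

end Dictionary

end TameBranchAnalyticSha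

end Summit.BirchSwinnertonDyer.Rank1Residual.Additive

end
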